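import Summits.AnomalousDissipation.AnomalousDissipation.Theorems.SawtoothPulseCascadeK1LocalisedCascadeSlotPullback

/-!
# K1loc, line `Spectral` / SeqCone — helper: COEFFICIENTS OF DERIVATIVE MULTIPLIERS READ OFF ONE COORDINATE (B3b core)

Helper file of the prover lane on the crux `K1LocalisedCascade` (stmt-AnomalousDissipation-19491), route
`SawtoothPulseCascade` (NOTES HANDOFF B3b).  The higher-order expansion (`…SlotExpansion`) takes "derivative multipliers"
`Θ_α` with `𝓕Θ_α(q) = (2πi q_j)^α 𝓕Θ(q)`.  For multipliers read off one coordinate, `Θ(x) = φ(x_j)` with `φ` the circle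
function of a smooth `1`-periodic `f : ℝ → ℂ`, the derivative multipliers are `x ↦ φ_α(x_j)` with `f_α = f^{(α)}`, and
the coefficient relation is ONE-dimensional integration by parts (`fourierCoeffOn_of_hasDerivAt`) transported by
`mFourierCoeff_comp_eval`.  Results: `fourierCoeff_periodicLift_eq_fourierCoeffOn`, `fourierCoeff_periodicLift_deriv`,
`mFourierCoeff_comp_eval_periodicLift_deriv`, `mFourierCoeff_comp_eval_periodicLift_iterate` (the relation for a whole
family `f_{α+1} = f_α'`), `continuous_periodicLift`, `isSmooth_comp_eval_periodicLift`.  No definitions; no statement about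
the stub.
[cite: Grafakos2014, Prop. 3.1.2 (5) (coefficients of derivatives and of functions of one coordinate)] [problem: turb]
-/

-- `Summit.<Summit>.<Problem>`: single-conjunct summit, the duplicate namespace segment is deliberate.
set_option linter.dupNamespace false

noncomputable section

namespace Summit.AnomalousDissipation.AnomalousDissipation.Theorems.SawtoothPulseCascade.K1Slot

open MeasureTheory Set Filter Topology UnitAddTorus Complex
open scoped ContDiff
open Literature.Analysis Literature.Analysis.FunctionSpaces Literature.Analysis.FunctionSpaces.Torus

/-! ## One dimension: coefficients of the circle function of a periodic function and of its derivative -/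

/-- The circle function of a continuous `1`-periodic `f : ℝ → ℂ` is continuous. [folklore] -/
theorem continuous_periodicLift {f : ℝ → ℂ} (hf : Continuous f) (hp : Function.Periodic f 1) :
    Continuous (hp.lift : UnitAddCircle → ℂ) := by
  have h : (hp.lift : UnitAddCircle → ℂ) ∘ (QuotientAddGroup.mk : ℝ → UnitAddCircle) = f := by
    funext x; exact hp.lift_coe x
  rw [(QuotientAddGroup.isQuotientMap_mk _).continuous_iff]
  change Continuous ((hp.lift : UnitAddCircle → ℂ) ∘ (QuotientAddGroup.mk : ℝ → UnitAddCircle))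
  rw [h]
  exact hf

/-- **The Fourier coefficients of the circle function as an integral over `[0,1]`.** [folklore] -/
theorem fourierCoeff_periodicLift_eq_integral {f : ℝ → ℂ} (hp : Function.Periodic f 1) (n : ℤ) :
    fourierCoeff (hp.lift : UnitAddCircle → ℂ) n = ∫ x in (0 : ℝ)..1, fourier (-n) (x : UnitAddCircle) * f x := by
  rw [fourierCoeff_eq_intervalIntegral _ n 0, zero_add, one_div, inv_one, one_smul]
  refine intervalIntegral.integral_congr fun x _ => ?_
  simp only [hp.lift_coe, smul_eq_mul]

/-- **Coefficients of the derivative of a periodic function**: for `f` `1`-periodic with continuous `1`-periodic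
derivative `f'`, `𝓕(f')(n) = 2πi n · 𝓕(f)(n)` (integration by parts; the boundary term vanishes by periodicity).
[cite: Grafakos2014, Prop. 3.1.2 (5)] -/
theorem fourierCoeff_periodicLift_deriv {f f' : ℝ → ℂ} (hp : Function.Periodic f 1) (hp' : Function.Periodic f' 1)
    (hff' : ∀ y, HasDerivAt f (f' y) y) (hf'c : Continuous f') (n : ℤ) :
    fourierCoeff (hp'.lift : UnitAddCircle → ℂ) n = (2 * Real.pi * I * n) * fourierCoeff (hp.lift : UnitAddCircle → ℂ) n := by
  rw [fourierCoeff_periodicLift_eq_integral hp', fourierCoeff_periodicLift_eq_integral hp]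
  have hfc : Continuous f := continuous_iff_continuousAt.mpr fun y => (hff' y).continuousAt
  have hu : ∀ x ∈ uIcc (0 : ℝ) 1, HasDerivAt (fun y : ℝ => fourier (-n) (y : UnitAddCircle))
      (-2 * Real.pi * I * n / 1 * fourier (-n) (x : UnitAddCircle)) x := fun x _ => hasDerivAt_fourier_neg 1 n x
  have hv : ∀ x ∈ uIcc (0 : ℝ) 1, HasDerivAt f (f' x) x := fun x _ => hff' x
  have hu'c : Continuous fun x : ℝ => -2 * Real.pi * I * n / 1 * fourier (-n) (x : UnitAddCircle) :=
    continuous_const.mul ((fourier (-n)).continuous.comp continuous_quotient_mk')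
  have h := intervalIntegral.integral_mul_deriv_eq_deriv_mul hu hv (hu'c.intervalIntegrable 0 1) (hf'c.intervalIntegrable 0 1)
  rw [h]
  -- boundary term: `(1 : UnitAddCircle) = 0` and `f 1 = f 0`
  have h1 : ((1 : ℝ) : UnitAddCircle) = ((0 : ℝ) : UnitAddCircle) := by
    rw [AddCircle.coe_period, QuotientAddGroup.mk_zero]
  have hf1 : f 1 = f 0 := by simpa using hp 0
  rw [h1, hf1, sub_self, zero_sub, ← intervalIntegral.integral_neg, ← intervalIntegral.integral_const_mul]
  refine intervalIntegral.integral_congr fun x _ => ?_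
  simp only [div_one]
  ring

/-! ## On the torus: multipliers read off the coordinate `x_j` -/

variable {d : Type*} [Fintype d] [DecidableEq d]

/-- **Coefficients of a derivative multiplier read off `x_j`**: with `φ, φ'` the circle functions of `f, f'` as above,
`𝓕(x ↦ φ'(x_j))(q) = 2πi q_j · 𝓕(x ↦ φ(x_j))(q)` on `T^d`. [cite: Grafakos2014, Prop. 3.1.2 (5)] -/
theorem mFourierCoeff_comp_eval_periodicLift_deriv {f f' : ℝ → ℂ} (hp : Function.Periodic f 1)
    (hp' : Function.Periodic f' 1) (hff' : ∀ y, HasDerivAt f (f' y) y) (hf'c : Continuous f') (j : d) (q : d → ℤ) :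
    mFourierCoeff (fun x : UnitAddTorus d => (hp'.lift : UnitAddCircle → ℂ) (x j)) q =
      (2 * Real.pi * I * (q j : ℂ)) * mFourierCoeff (fun x : UnitAddTorus d => (hp.lift : UnitAddCircle → ℂ) (x j)) q := by
  have hfc : Continuous f := continuous_iff_continuousAt.mpr fun y => (hff' y).continuousAt
  rw [mFourierCoeff_comp_eval (continuous_periodicLift hf'c hp') j q,
    mFourierCoeff_comp_eval (continuous_periodicLift hfc hp) j q]
  split_ifs with h
  · exact fourierCoeff_periodicLift_deriv hp hp' hff' hf'c (q j)
  · rw [mul_zero]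

/-- **The whole family**: for `1`-periodic `f_α : ℝ → ℂ` with `f_α' = f_{α+1}` (all continuous),
`𝓕(x ↦ φ_α(x_j))(q) = (2πi q_j)^α 𝓕(x ↦ φ_0(x_j))(q)` — the hypothesis `hΘd` of `…SlotExpansion`.
[cite: Grafakos2014, Prop. 3.1.2 (5)] -/
theorem mFourierCoeff_comp_eval_periodicLift_iterate {f : ℕ → ℝ → ℂ} (hp : ∀ α, Function.Periodic (f α) 1)
    (hd : ∀ α y, HasDerivAt (f α) (f (α + 1) y) y) (hc : ∀ α, Continuous (f α)) (j : d) (α : ℕ) (q : d → ℤ) :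
    mFourierCoeff (fun x : UnitAddTorus d => ((hp α).lift : UnitAddCircle → ℂ) (x j)) q =
      (2 * Real.pi * I * (q j : ℂ)) ^ α * mFourierCoeff (fun x : UnitAddTorus d => ((hp 0).lift : UnitAddCircle → ℂ) (x j)) q := by
  induction α with
  | zero => rw [pow_zero, one_mul]
  | succ α ih =>
    rw [mFourierCoeff_comp_eval_periodicLift_deriv (hp α) (hp (α + 1)) (hd α) (hc (α + 1)) j q, ih, pow_succ]
    ring

omit [DecidableEq d] in
/-- A multiplier read off `x_j` from a smooth periodic function is smooth on `T^d`. [folklore] -/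
theorem isSmooth_comp_eval_periodicLift {f : ℝ → ℂ} (hp : Function.Periodic f 1) (hs : ContDiff ℝ ∞ f) (j : d) :
    IsSmooth (fun x : UnitAddTorus d => (hp.lift : UnitAddCircle → ℂ) (x j)) := by
  have h : lift (fun x : UnitAddTorus d => (hp.lift : UnitAddCircle → ℂ) (x j)) = fun y => f (y j) := by
    funext y; rw [lift_apply, proj_apply, hp.lift_coe]
  unfold IsSmooth
  rw [h]
  exact hs.comp (EuclideanSpace.proj j : EuclideanSpace ℝ d →L[ℝ] ℝ).contDiff

omit [Fintype d] [DecidableEq d] in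
/-- Sup bound transfer: `‖φ(x_j)‖ ≤ B` if `‖f‖ ≤ B`. [folklore] -/
theorem norm_comp_eval_periodicLift_le {f : ℝ → ℂ} (hp : Function.Periodic f 1) {B : ℝ} (hB : ∀ y, ‖f y‖ ≤ B) (j : d)
    (x : UnitAddTorus d) : ‖(hp.lift : UnitAddCircle → ℂ) (x j)‖ ≤ B := by
  induction x j using QuotientAddGroup.induction_on with
  | H y => rw [hp.lift_coe]; exact hB y

omit [Fintype d] [DecidableEq d] in
/-- Pointwise-vanishing transfer: `conj(φ(x_j)) · ψ(x_j) = 0` on the torus if `conj(f y) · g y = 0` for all `y`. [folklore] -/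
theorem conj_comp_eval_periodicLift_mul_eq_zero {f g : ℝ → ℂ} (hpf : Function.Periodic f 1) (hpg : Function.Periodic g 1)
    (h : ∀ y, (starRingEnd ℂ) (f y) * g y = 0) (j : d) (x : UnitAddTorus d) :
    (starRingEnd ℂ) ((hpf.lift : UnitAddCircle → ℂ) (x j)) * (hpg.lift : UnitAddCircle → ℂ) (x j) = 0 := by
  induction x j using QuotientAddGroup.induction_on with
  | H y => rw [hpf.lift_coe, hpg.lift_coe]; exact h y

end Summit.AnomalousDissipation.AnomalousDissipation.Theorems.SawtoothPulseCascade.K1Slot
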